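import Mathlib
import Summits.CriticalPhenomena.PercolationContinuityZ3.Theorems.PercNearOneGluingNoHeavyLowerTailMomentRatioTN
import Summits.CriticalPhenomena.PercolationContinuityZ3.Theorems.PercNearOneGluingNoHeavyLowerTailTNKernels
import HarnessLib

/-!
# The rank-two Neville criterion ("W♯² criterion"): quadratic rows annihilated by two functionals

Support file for the Sahi / Conjecture-P programme of route `PercNearOneGluingNoHeavy`
(`--supports stmt-CriticalPhenomena-4575`, prover prim-l12-p5 gen 44; proof notes
`prim-l12-p5/PROOF-QB1-HYPERGEOMETRIC-g44.md` §4 (THEOREM 1, (4.6)) and `PROOF-THREE-RAYS-g43.md` §2).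
No definitions, no named facts, no sorries.

`…LowerTailMomentRatioTN` (THEOREM W♯) treats row families `(1+x)^{n-1}(x+σ_n)` annihilated by ONE functional.
Here: TWO functionals `L₁, L₂` with moments `μ, ν`.  The rows are `r_0 = 1`, `r_1 = ν_0 y - ν_1` (killed by `L₂`)
and, for `n ≥ 2`, the `3 × 3` determinant row `r_n = cas(n-1) y^{n-2} - cas₂(n-2) y^{n-1} + cas(n-2) y^n`
(`cas(k) = μ_k ν_{k+1} - μ_{k+1} ν_k`, `cas₂(k) = μ_k ν_{k+2} - μ_{k+2} ν_k`), killed by both; the kernel is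
`K(n,l) = [x^l] r_n(1+x)`.  Every lower-triangular matrix whose rows `n ≥ 2` lie in `span(y^{n-2},y^{n-1},y^n)`
and are killed by `L₁, L₂` (row 1 by `L₂`) is `diag · K` — e.g. the three-ray `x`-Laplace matrix at `q_B = 1`
in Type I (memo §4).

* `neville2_step` — the rank-two Neville step: `K(n+1,l) - (s_{n+1}/s_n) K(n,l) = κ_n K'(n,l-1)` where `K'` is the
  kernel of the twisted pair `(μ - μ(·+1), ν - ν(·+1))`, `s_n = K(n,0)` and `κ_0 = ν_0`, `κ_1 = cas(0)/(ν_0-ν_1)`,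
  `κ_n = cas_{μ,ν}(n-1)/cas_{μ',ν'}(n-2)` (`n ≥ 2`) — a polynomial identity after Pascal's rule.
* `twoFunctional_minor_nonneg` / `twoFunctional_tn` — **THEOREM W♯² (⟸)**: if all twisted Casoratians
  `Δ^k μ(a) Δ^k ν(a+1) - Δ^k μ(a+1) Δ^k ν(a)` (`Δ^k u(a) = Σ_i (-1)^i C(k,i) u(a+i)`; these are the bideterminants
  `N(a,k)` of memo §4) and all `Δ^k ν(0)` are positive, then `K` is totally nonnegative
  (`K = L̂ · (1 ⊕ diag(κ) K')`, induction as in THEOREM W♯).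
-/

namespace Summit.CriticalPhenomena.PercolationContinuityZ3.Theorems

namespace TwoFunctionalTN

open Finset Matrix MomentRatioTN
open scoped Nat

/-! ### The Neville step -/

set_option maxRecDepth 16384 in
/-- **The rank-two Neville step.**  `K` is the kernel of `(μ, ν)`, `K'` that of the twisted pair; with
`s_n = K(n,0)` (assumed nonzero) and the scalars `κ`:  `K(n+1,l) = [1 ⊕ diag(κ)K'](n+1,l) + (s_{n+1}/s_n) K(n,l)`. -/
theorem neville2_step (μ ν : ℕ → ℝ) (K K' : ℕ → ℕ → ℝ)
    (hK0 : ∀ l, K 0 l = if l = 0 then 1 else 0)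
    (hK1 : ∀ l, K 1 l = ν 0 * ((1 : ℕ).choose l : ℝ) - ν 1 * ((0 : ℕ).choose l : ℝ))
    (hK2 : ∀ n l, K (n + 2) l = (μ (n + 1) * ν (n + 2) - μ (n + 2) * ν (n + 1)) * (n.choose l : ℝ)
      - (μ n * ν (n + 2) - μ (n + 2) * ν n) * ((n + 1).choose l : ℝ)
      + (μ n * ν (n + 1) - μ (n + 1) * ν n) * ((n + 2).choose l : ℝ))
    (hK'0 : ∀ l, K' 0 l = if l = 0 then 1 else 0)
    (hK'1 : ∀ l, K' 1 l = (ν 0 - ν 1) * ((1 : ℕ).choose l : ℝ) - (ν 1 - ν 2) * ((0 : ℕ).choose l : ℝ))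
    (hK'2 : ∀ n l, K' (n + 2) l =
      ((μ (n + 1) - μ (n + 2)) * (ν (n + 2) - ν (n + 3)) - (μ (n + 2) - μ (n + 3)) * (ν (n + 1) - ν (n + 2)))
          * (n.choose l : ℝ)
      - ((μ n - μ (n + 1)) * (ν (n + 2) - ν (n + 3)) - (μ (n + 2) - μ (n + 3)) * (ν n - ν (n + 1)))
          * ((n + 1).choose l : ℝ)
      + ((μ n - μ (n + 1)) * (ν (n + 1) - ν (n + 2)) - (μ (n + 1) - μ (n + 2)) * (ν n - ν (n + 1)))
          * ((n + 2).choose l : ℝ))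
    (κ : ℕ → ℝ) (hκ0 : κ 0 = ν 0) (hκ1 : κ 1 = (μ 0 * ν 1 - μ 1 * ν 0) / (ν 0 - ν 1))
    (hκ2 : ∀ n, κ (n + 2) = (μ (n + 1) * ν (n + 2) - μ (n + 2) * ν (n + 1)) /
      ((μ n - μ (n + 1)) * (ν (n + 1) - ν (n + 2)) - (μ (n + 1) - μ (n + 2)) * (ν n - ν (n + 1))))
    (hs : ∀ n, K n 0 ≠ 0) (hν : ν 0 - ν 1 ≠ 0)
    (hcas' : ∀ n, (μ n - μ (n + 1)) * (ν (n + 1) - ν (n + 2)) - (μ (n + 1) - μ (n + 2)) * (ν n - ν (n + 1)) ≠ 0)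
    (n l : ℕ) :
    K (n + 1) l = (if n + 1 = 0 ∧ l = 0 then (1 : ℝ) else if n + 1 = 0 ∨ l = 0 then 0
        else κ (n + 1 - 1) * K' (n + 1 - 1) (l - 1)) + K (n + 1) 0 / K n 0 * K n l := by
  simp only [Nat.add_one_ne_zero, false_and, false_or, if_false, Nat.add_sub_cancel]
  rcases n with _ | _ | n
  · -- row 1 from row 0
    rw [hK1, hK1, hK0, hK0]
    rcases l with _ | _ | l
    · simp
    · simp [hκ0, hK'0]
    · simp [hK'0]
  · -- row 2 from row 1
    have h2 := hK2 0
    simp only [zero_add] at h2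
    rw [h2, h2, hK1, hK1]
    rcases l with _ | _ | _ | l
    · simp
      field_simp
    · simp [hκ1, hK'1]
      field_simp
      ring
    · simp [hκ1, hK'1]
      field_simp
    · have c0 : Nat.choose 0 (l + 3) = 0 := Nat.choose_eq_zero_of_lt (by omega)
      have c1 : Nat.choose 1 (l + 3) = 0 := Nat.choose_eq_zero_of_lt (by omega)
      have c2 : Nat.choose 2 (l + 3) = 0 := Nat.choose_eq_zero_of_lt (by omega)
      have c0' : Nat.choose 0 (l + 2) = 0 := Nat.choose_eq_zero_of_lt (by omega)
      have c1' : Nat.choose 1 (l + 2) = 0 := Nat.choose_eq_zero_of_lt (by omega)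
      rw [hK'1]
      simp only [c0, c1, c2, c0', c1', Nat.cast_zero, mul_zero, add_zero, zero_add, sub_self,
        show l + 3 ≠ 0 by omega, if_false, show l + 3 - 1 = l + 2 by omega]
  · -- row n+3 from row n+2
    have h3 := hK2 (n + 1)
    have e3 : n + 1 + 2 = n + 3 := by omega
    have e2 : n + 1 + 1 = n + 2 := by omega
    simp only [e3, e2] at h3
    have hsn := hs (n + 2)
    rw [hK2 n 0] at hsn
    rw [h3, h3, hK2, hK2, hκ2]
    have hc := hcas' n
    rcases l with _ | l
    · simp only [Nat.choose_zero_right, Nat.cast_one, mul_one, if_true, zero_add] at hsn ⊢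
      exact (div_mul_cancel₀ _ hsn).symm
    · simp only [Nat.add_one_ne_zero, if_false, Nat.add_sub_cancel]
      rw [hK'2]
      -- Pascal: reduce to the atoms C(n,l+1), C(n,l), C(n+1,l), C(n+2,l)
      have p1 : ((n + 1).choose (l + 1) : ℝ) = (n.choose l : ℝ) + (n.choose (l + 1) : ℝ) := by
        rw [Nat.choose_succ_succ]; push_cast; ring
      have p2 : ((n + 2).choose (l + 1) : ℝ) = ((n + 1).choose l : ℝ) + (n.choose l : ℝ) + (n.choose (l + 1) : ℝ) := by
        rw [show n + 2 = (n + 1) + 1 from rfl, Nat.choose_succ_succ, Nat.choose_succ_succ]; push_cast; ring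
      have p3 : ((n + 3).choose (l + 1) : ℝ) =
          ((n + 2).choose l : ℝ) + ((n + 1).choose l : ℝ) + (n.choose l : ℝ) + (n.choose (l + 1) : ℝ) := by
        rw [show n + 3 = (n + 2) + 1 from rfl, Nat.choose_succ_succ, show n + 2 = (n + 1) + 1 from rfl,
          Nat.choose_succ_succ, Nat.choose_succ_succ]; push_cast; ring
      simp only [Nat.choose_zero_right, Nat.cast_one, mul_one] at hsn ⊢
      rw [p1, p2, p3, div_mul_eq_mul_div, div_mul_eq_mul_div, div_add_div _ _ hc hsn, eq_div_iff (mul_ne_zero hc hsn)]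
      ring

/-! ### THEOREM W♯² -/

/-- **THEOREM W♯² (⟸), finite sections.**  If all twisted Casoratians `Δ^kμ(a)Δ^kν(a+1) - Δ^kμ(a+1)Δ^kν(a)` and all
`Δ^kν(0)` are positive, every minor of the two-functional kernel `K` inside the leading `N × N` block is `≥ 0`. -/
theorem twoFunctional_minor_nonneg (N : ℕ) : ∀ (μ ν : ℕ → ℝ) (K : ℕ → ℕ → ℝ),
    (∀ l, K 0 l = if l = 0 then 1 else 0) →
    (∀ l, K 1 l = ν 0 * ((1 : ℕ).choose l : ℝ) - ν 1 * ((0 : ℕ).choose l : ℝ)) →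
    (∀ n l, K (n + 2) l = (μ (n + 1) * ν (n + 2) - μ (n + 2) * ν (n + 1)) * (n.choose l : ℝ)
      - (μ n * ν (n + 2) - μ (n + 2) * ν n) * ((n + 1).choose l : ℝ)
      + (μ n * ν (n + 1) - μ (n + 1) * ν n) * ((n + 2).choose l : ℝ)) →
    (∀ k a, 0 < (∑ i ∈ range (k + 1), (-1 : ℝ) ^ i * (k.choose i : ℝ) * μ (a + i)) *
        (∑ i ∈ range (k + 1), (-1 : ℝ) ^ i * (k.choose i : ℝ) * ν (a + 1 + i))
      - (∑ i ∈ range (k + 1), (-1 : ℝ) ^ i * (k.choose i : ℝ) * μ (a + 1 + i)) *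
        (∑ i ∈ range (k + 1), (-1 : ℝ) ^ i * (k.choose i : ℝ) * ν (a + i))) →
    (∀ k, 0 < ∑ i ∈ range (k + 1), (-1 : ℝ) ^ i * (k.choose i : ℝ) * ν (0 + i)) →
    ∀ (k : ℕ) (r c : Fin k → ℕ), StrictMono r → StrictMono c → (∀ i, r i < N) → (∀ j, c j < N) →
    0 ≤ (Matrix.of fun i j => K (r i) (c j)).det := by
  induction N with
  | zero =>
    intro μ ν K _ _ _ _ _ k r c hr hc hrN hcN
    cases k with
    | zero => simp
    | succ k => exact absurd (hrN 0) (Nat.not_lt_zero _)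
  | succ N ih =>
    intro μ ν K hK0 hK1 hK2 hA hB k r c hr hc hrN hcN
    -- level-0 and level-1 consequences of the hypotheses
    have hcas : ∀ a, 0 < μ a * ν (a + 1) - μ (a + 1) * ν a := by
      intro a; have h := hA 0 a; simpa using h
    have hcas1 : ∀ a, 0 < (μ a - μ (a + 1)) * (ν (a + 1) - ν (a + 2)) - (μ (a + 1) - μ (a + 2)) * (ν a - ν (a + 1)) := by
      intro a; have h := hA 1 a
      simp [sum_range_succ] at h
      nlinarith [h]
    have hν0 : 0 < ν 0 := by have h := hB 0; simpa using h
    have hν01 : 0 < ν 0 - ν 1 := by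
      have h := hB 1; simp [sum_range_succ] at h; linarith
    -- the pivots s_n = K n 0 are positive
    have hspos : ∀ n, 0 < K n 0 := by
      intro n
      rcases n with _ | _ | n
      · rw [hK0]; simp
      · rw [hK1]; simp; linarith
      · rw [hK2]; simp
        nlinarith [hcas1 n]
    -- the twisted pair and its kernel
    set μ' : ℕ → ℝ := fun a => μ a - μ (a + 1) with hμ'
    set ν' : ℕ → ℝ := fun a => ν a - ν (a + 1) with hν'
    let K' : ℕ → ℕ → ℝ := fun n l =>
      if n = 0 then (if l = 0 then 1 else 0)
      else if n = 1 then (ν' 0 * ((1 : ℕ).choose l : ℝ) - ν' 1 * ((0 : ℕ).choose l : ℝ))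
      else ((μ' (n - 1) * ν' n - μ' n * ν' (n - 1)) * ((n - 2).choose l : ℝ)
        - (μ' (n - 2) * ν' n - μ' n * ν' (n - 2)) * ((n - 1).choose l : ℝ)
        + (μ' (n - 2) * ν' (n - 1) - μ' (n - 1) * ν' (n - 2)) * (n.choose l : ℝ))
    have hK'0 : ∀ l, K' 0 l = if l = 0 then 1 else 0 := fun l => by simp [K']
    have hK'1 : ∀ l, K' 1 l = ν' 0 * ((1 : ℕ).choose l : ℝ) - ν' 1 * ((0 : ℕ).choose l : ℝ) := fun l => by
      simp [K']
    have hK'2 : ∀ n l, K' (n + 2) l = (μ' (n + 1) * ν' (n + 2) - μ' (n + 2) * ν' (n + 1)) * (n.choose l : ℝ)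
        - (μ' n * ν' (n + 2) - μ' (n + 2) * ν' n) * ((n + 1).choose l : ℝ)
        + (μ' n * ν' (n + 1) - μ' (n + 1) * ν' n) * ((n + 2).choose l : ℝ) := fun n l => by
      simp only [K', Nat.add_one_ne_zero, if_false, show n + 2 ≠ 1 by omega, show n + 2 - 1 = n + 1 by omega,
        show n + 2 - 2 = n by omega]
    -- the hypotheses are twist-stable
    have hA' : ∀ k a, 0 < (∑ i ∈ range (k + 1), (-1 : ℝ) ^ i * (k.choose i : ℝ) * μ' (a + i)) *
        (∑ i ∈ range (k + 1), (-1 : ℝ) ^ i * (k.choose i : ℝ) * ν' (a + 1 + i))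
      - (∑ i ∈ range (k + 1), (-1 : ℝ) ^ i * (k.choose i : ℝ) * μ' (a + 1 + i)) *
        (∑ i ∈ range (k + 1), (-1 : ℝ) ^ i * (k.choose i : ℝ) * ν' (a + i)) := by
      intro k a
      have h := hA (k + 1) a
      rw [altSum_succ μ k a, altSum_succ ν k (a + 1), altSum_succ μ k (a + 1), altSum_succ ν k a] at h
      simpa [hμ', hν'] using h
    have hB' : ∀ k, 0 < ∑ i ∈ range (k + 1), (-1 : ℝ) ^ i * (k.choose i : ℝ) * ν' (0 + i) := by
      intro k
      have h := hB (k + 1)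
      rw [altSum_succ ν k 0] at h
      simpa [hν'] using h
    have ih' := ih μ' ν' K' hK'0 hK'1 hK'2 hA' hB'
    -- the scalars κ
    let κ : ℕ → ℝ := fun n => if n = 0 then ν 0 else if n = 1 then (μ 0 * ν 1 - μ 1 * ν 0) / (ν 0 - ν 1)
      else (μ (n - 1) * ν n - μ n * ν (n - 1)) / (μ' (n - 2) * ν' (n - 1) - μ' (n - 1) * ν' (n - 2))
    have hκpos : ∀ n, 0 < κ n := by
      intro n
      rcases n with _ | _ | n
      · simp [κ]; exact hν0
      · simp [κ]; exact div_pos (by nlinarith [hcas 0]) hν01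
      · simp only [κ, Nat.add_one_ne_zero, if_false, show n + 2 ≠ 1 by omega, show n + 2 - 1 = n + 1 by omega,
          show n + 2 - 2 = n by omega, hμ', hν']
        exact div_pos (hcas (n + 1)) (hcas1 n)
    -- Neville: K = L̂ · M with M = 1 ⊕ diag(κ) K'
    have key := sum_form K
      (fun n l => if n = 0 ∧ l = 0 then (1 : ℝ) else if n = 0 ∨ l = 0 then 0 else κ (n - 1) * K' (n - 1) (l - 1))
      (fun n => K n 0) (fun n => (hspos n).ne')
      (fun l => by rw [hK0]; by_cases hl : l = 0 <;> simp [hl])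
      (fun n l => by
        have h := neville2_step μ ν K K' hK0 hK1 hK2 hK'0
          (fun l => by rw [hK'1])
          (fun n l => by rw [hK'2])
          κ (by simp [κ]) (by simp [κ])
          (fun n => by
            simp only [κ, Nat.add_one_ne_zero, if_false, show n + 2 ≠ 1 by omega,
              show n + 2 - 1 = n + 1 by omega, show n + 2 - 2 = n by omega, hμ', hν'])
          (fun n => (hspos n).ne') hν01.ne' (fun n => (hcas1 n).ne') n l
        simpa using h)
    have hmat : (Matrix.of fun i j => K (r i) (c j)) =
        Matrix.of fun i j => ∑ t ∈ range (r i + 1),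
          (fun n t => if t ≤ n then K n 0 / K t 0 else 0) (r i) t *
          (fun n l => if n = 0 ∧ l = 0 then (1 : ℝ) else if n = 0 ∨ l = 0 then 0
            else κ (n - 1) * K' (n - 1) (l - 1)) t (c j) := by
      ext i j
      exact key (r i) (c j)
    rw [hmat]
    refine TNKernel.mulLower_minor_nonneg
      (fun n t => if t ≤ n then K n 0 / K t 0 else 0)
      (fun n l => if n = 0 ∧ l = 0 then (1 : ℝ) else if n = 0 ∨ l = 0 then 0 else κ (n - 1) * K' (n - 1) (l - 1))
      (N + 1) ?_ ?_ ?_ r c hr hc hrN hcN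
    · -- L̂ is TN
      intro k r c hr hc
      exact TNKernel.ratioStair_minor_nonneg _ hspos r c hr hc
    · -- 1 ⊕ diag(κ) K' is TN up to N + 1
      intro k r c hr hc hrN hcN
      refine TNKernel.blockOne_minor_nonneg (fun n l => κ n * K' n l) N ?_ r c hr hc hrN hcN
      intro k r c hr hc hrN hcN
      have hsc : (Matrix.of fun i j => κ (r i) * K' (r i) (c j)) =
          Matrix.of fun i j => κ (r i) * K' (r i) (c j) * (fun _ : ℕ => (1 : ℝ)) (c j) := by
        ext i j; simp
      rw [hsc, TNKernel.det_kernel_scale K' κ (fun _ => (1 : ℝ)) r c]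
      exact mul_nonneg (prod_pos fun i _ => hκpos (r i)).le
        (mul_nonneg (by simp) (ih' k r c hr hc hrN hcN))
    · intro n j hnj
      simp [not_le.2 hnj]

/-- **THEOREM W♯² (⟸).**  Under the positivity of all twisted Casoratians of `(μ, ν)` and of all `Δ^kν(0)`,
the two-functional kernel `K` is totally nonnegative. -/
theorem twoFunctional_tn (μ ν : ℕ → ℝ) (K : ℕ → ℕ → ℝ)
    (hK0 : ∀ l, K 0 l = if l = 0 then 1 else 0)
    (hK1 : ∀ l, K 1 l = ν 0 * ((1 : ℕ).choose l : ℝ) - ν 1 * ((0 : ℕ).choose l : ℝ))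
    (hK2 : ∀ n l, K (n + 2) l = (μ (n + 1) * ν (n + 2) - μ (n + 2) * ν (n + 1)) * (n.choose l : ℝ)
      - (μ n * ν (n + 2) - μ (n + 2) * ν n) * ((n + 1).choose l : ℝ)
      + (μ n * ν (n + 1) - μ (n + 1) * ν n) * ((n + 2).choose l : ℝ))
    (hA : ∀ k a, 0 < (∑ i ∈ range (k + 1), (-1 : ℝ) ^ i * (k.choose i : ℝ) * μ (a + i)) *
        (∑ i ∈ range (k + 1), (-1 : ℝ) ^ i * (k.choose i : ℝ) * ν (a + 1 + i))
      - (∑ i ∈ range (k + 1), (-1 : ℝ) ^ i * (k.choose i : ℝ) * μ (a + 1 + i)) *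
        (∑ i ∈ range (k + 1), (-1 : ℝ) ^ i * (k.choose i : ℝ) * ν (a + i)))
    (hB : ∀ k, 0 < ∑ i ∈ range (k + 1), (-1 : ℝ) ^ i * (k.choose i : ℝ) * ν (0 + i))
    {k : ℕ} (r c : Fin k → ℕ) (hr : StrictMono r) (hc : StrictMono c) :
    0 ≤ (Matrix.of fun i j => K (r i) (c j)).det := by
  refine twoFunctional_minor_nonneg ((univ.sup r) + (univ.sup c) + 1) μ ν K hK0 hK1 hK2 hA hB k r c hr hc
    (fun i => ?_) (fun j => ?_)
  · have : r i ≤ univ.sup r := Finset.le_sup (f := r) (mem_univ i)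
    omega
  · have : c j ≤ univ.sup c := Finset.le_sup (f := c) (mem_univ j)
    omega

end TwoFunctionalTN

end Summit.CriticalPhenomena.PercolationContinuityZ3.Theorems
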